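import Mathlib.Analysis.SpecialFunctions.Pow.Complex
import Mathlib.Analysis.SpecialFunctions.Complex.LogBounds
import Mathlib.NumberTheory.SmoothNumbers
import HarnessLib

/-!
# Lower bounds for `∑_p p^{−α}(1 − Re(z_p p^{−it}))` from short-interval prime sums

Topic `Literature/NumberTheory/Sieve`; a PROVED real-variable tool file toward
`Literature.NumberTheory.DiophantineGeometry.XYZUpperHalf` ([Harper2016, Cor. 1]; the decay of
`L(α+it, χ; y)/ζ(α, y)` for non-principal `χ` at a level `y` where Gallagher's prime number theorem
for characters holds in short intervals). Abstractly: let `L < P ≤ Y` be naturals, `B` the primes of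
`(L, P]`, `hh = P − L`, and `z : ℕ → ℂ` with `‖z_p‖ ≤ 1`. If the primes of `B` are regular
(`|∑_B log p − hh| ≤ δ hh`) and `z` cancels on `B` (`‖∑_B z_p log p‖ ≤ δ hh`) with `δ ≤ 1/10`, the
block is short (`20 hh ≤ L`, `|t| hh ≤ L/20`) and not too low (`log L ≥ 20`, `log Y ≤ (10/9) log L`),
then

`block_decay_lower_bound`: `(1/4) hh P^{−α}/log Y ≤ ∑_{p ∈ B} p^{−α} (1 − Re(z_p p^{−it}))` (`0 ≤ α ≤ 1`),

and summing consecutive blocks (`sum_blocks_decay_lower_bound`) gives the lower bound over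
`(Y − Jh, Y]`. The number-theoretic input (Gallagher at a good level) is supplied elsewhere.

## References

* A. J. Harper, Compositio Math. 152 (2016), Appendix (character sums over smooth numbers in the
  Linnik range) [Harper2016].
* P. X. Gallagher, Invent. Math. 11 (1970), Theorem 7 [Gallagher1970].
-/

noncomputable section

open Finset Real Complex

namespace Literature.NumberTheory.Sieve

namespace SmoothArcs

/-- The primes of `(L, P]`. [folklore] -/
def primeBlock (L P : ℕ) : Finset ℕ := (Finset.Ioc L P).filter Nat.Prime

/-- Membership in a prime block. [folklore] -/
theorem mem_primeBlock {L P p : ℕ} : p ∈ primeBlock L P ↔ (L < p ∧ p ≤ P) ∧ p.Prime := by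
  simp [primeBlock]

/-! ### Complex powers on a short block -/

/-- `‖p^{−(α+it)}‖ = p^{−α}` for `p ≥ 1` (a private copy of `TwistedWeight.norm_natCast_cpow_neg`, to keep
this file's imports within Mathlib). [folklore] -/
private theorem norm_natCast_cpow_neg_add {p : ℕ} (hp : 0 < p) (α t : ℝ) :
    ‖(p : ℂ) ^ (-((α : ℂ) + t * I))‖ = (p : ℝ) ^ (-α) := by
  rw [Complex.norm_natCast_cpow_of_pos hp]; simp

/-- On a short block the complex power is almost constant: for `L < p ≤ P`, `20(P − L) ≤ L`,
`|t| (P − L) ≤ L/20`, `0 ≤ α ≤ 1`: `‖p^{−s} − P^{−s}‖ ≤ (1/5) p^{−α}`, `s = α + it`. [folklore] -/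
theorem norm_cpow_sub_cpow_block_le {L P p : ℕ} (hLp : L < p) (hpP : p ≤ P) (h20 : 20 * (P - L) ≤ L)
    {α t : ℝ} (hα0 : 0 ≤ α) (hα1 : α ≤ 1) (ht : |t| * ((P : ℝ) - L) ≤ (L : ℝ) / 20) :
    ‖(p : ℂ) ^ (-((α : ℂ) + t * I)) - (P : ℂ) ^ (-((α : ℂ) + t * I))‖ ≤ (1 / 5) * (p : ℝ) ^ (-α) := by
  have hp0 : 0 < p := lt_of_le_of_lt (Nat.zero_le L) hLp
  have hP0 : 0 < P := lt_of_lt_of_le hp0 hpP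
  have hp0r : (0 : ℝ) < p := by exact_mod_cast hp0
  have hP0r : (0 : ℝ) < P := by exact_mod_cast hP0
  have hL0r : (0 : ℝ) ≤ L := Nat.cast_nonneg L
  have hLP : L ≤ P := le_trans hLp.le hpP
  have hPL : ((P - L : ℕ) : ℝ) = (P : ℝ) - L := by rw [Nat.cast_sub hLP]
  have h20r : 20 * ((P : ℝ) - L) ≤ L := by
    have : ((20 * (P - L) : ℕ) : ℝ) ≤ L := by exact_mod_cast h20
    push_cast [Nat.cast_sub hLP] at this; linarith
  have hL1 : (1 : ℝ) ≤ L := by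
    -- `L ≥ 20 (P - L) ≥ 20` since `P - L ≥ 1`
    have : (1 : ℝ) ≤ (P : ℝ) - L := by
      have h1 : L + 1 ≤ p := hLp
      have : ((L + 1 : ℕ) : ℝ) ≤ p := by exact_mod_cast h1
      have hpP' : (p : ℝ) ≤ P := by exact_mod_cast hpP
      push_cast at this; linarith
    linarith
  have hL0r' : (0 : ℝ) < L := by linarith
  set s : ℂ := (α : ℂ) + t * I with hs
  -- `p^{-s} − P^{-s} = p^{-s} (1 − exp(−s log(P/p)))`
  have hlogp : Complex.log (p : ℂ) = ((Real.log p : ℝ) : ℂ) := (Complex.ofReal_log hp0r.le).symm ▸ by push_cast; rfl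
  have hpcpow : (p : ℂ) ^ (-s) = Complex.exp (-s * (Real.log p : ℝ)) := by
    rw [Complex.cpow_def_of_ne_zero (by exact_mod_cast hp0.ne'), ← Complex.ofReal_natCast, ← Complex.ofReal_log hp0r.le]
    ring_nf
  have hPcpow : (P : ℂ) ^ (-s) = Complex.exp (-s * (Real.log P : ℝ)) := by
    rw [Complex.cpow_def_of_ne_zero (by exact_mod_cast hP0.ne'), ← Complex.ofReal_natCast, ← Complex.ofReal_log hP0r.le]
    ring_nf
  set w : ℂ := s * ((Real.log P - Real.log p : ℝ) : ℂ) with hw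
  have hdiff : (p : ℂ) ^ (-s) - (P : ℂ) ^ (-s) = (p : ℂ) ^ (-s) * (1 - Complex.exp (-w)) := by
    rw [mul_sub, mul_one, hpcpow, hPcpow, ← Complex.exp_add]
    congr 2
    rw [hw]; push_cast; ring
  -- `‖w‖ ≤ (1 + |t|)(P − p)/p ≤ 1/10`
  have hlogPp : 0 ≤ Real.log P - Real.log p := by
    have := Real.log_le_log hp0r (by exact_mod_cast hpP : (p : ℝ) ≤ P); linarith
  have hlogPp' : Real.log P - Real.log p ≤ ((P : ℝ) - L) / L := by
    have h1 : Real.log P - Real.log p = Real.log ((P : ℝ) / p) := by rw [Real.log_div hP0r.ne' hp0r.ne']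
    rw [h1]
    have h2 : Real.log ((P : ℝ) / p) ≤ (P : ℝ) / p - 1 := Real.log_le_sub_one_of_pos (by positivity)
    have h3 : (P : ℝ) / p - 1 = ((P : ℝ) - p) / p := by field_simp
    have hLp' : (L : ℝ) < p := by exact_mod_cast hLp
    have h4 : ((P : ℝ) - p) / p ≤ ((P : ℝ) - L) / L := by
      rw [div_le_div_iff₀ hp0r hL0r']
      have hpP' : (p : ℝ) ≤ P := by exact_mod_cast hpP
      nlinarith
    linarith
  have hsnorm : ‖s‖ ≤ 1 + |t| := by
    calc ‖s‖ ≤ ‖(α : ℂ)‖ + ‖(t : ℂ) * I‖ := norm_add_le _ _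
      _ = |α| + |t| := by simp
      _ ≤ 1 + |t| := by rw [abs_of_nonneg hα0]; linarith
  have hwn : ‖w‖ ≤ 1 / 10 := by
    rw [hw, norm_mul, Complex.norm_real, Real.norm_eq_abs, abs_of_nonneg hlogPp]
    calc ‖s‖ * (Real.log P - Real.log p) ≤ (1 + |t|) * (((P : ℝ) - L) / L) :=
          mul_le_mul hsnorm hlogPp' hlogPp (by positivity)
      _ = (((P : ℝ) - L) + |t| * ((P : ℝ) - L)) / L := by ring
      _ ≤ ((L : ℝ) / 20 + L / 20) / L := by
          apply div_le_div_of_nonneg_right _ hL0r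
          linarith
      _ = 1 / 10 := by field_simp; ring
  have hexp : ‖1 - Complex.exp (-w)‖ ≤ 1 / 5 := by
    rw [← norm_neg, neg_sub]
    calc ‖Complex.exp (-w) - 1‖ ≤ 2 * ‖-w‖ := Complex.norm_exp_sub_one_le (by rw [norm_neg]; linarith)
      _ ≤ 1 / 5 := by rw [norm_neg]; linarith
  rw [hdiff, norm_mul, hs, norm_natCast_cpow_neg_add hp0]
  calc (p : ℝ) ^ (-α) * ‖1 - Complex.exp (-w)‖ ≤ (p : ℝ) ^ (-α) * (1 / 5) :=
        mul_le_mul_of_nonneg_left hexp (by positivity)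
    _ = 1 / 5 * (p : ℝ) ^ (-α) := by ring

/-! ### One block -/

set_option maxHeartbeats 1000000 in
/-- **The block estimate.** See the module docstring. [cite: Harper2016, Appendix] -/
theorem block_decay_lower_bound {L P Y : ℕ} (hLP : L < P) (hPY : P ≤ Y) (h20 : 20 * (P - L) ≤ L)
    (hlogL : 20 ≤ Real.log L) (hlogY : Real.log Y ≤ 10 / 9 * Real.log L)
    (z : ℕ → ℂ) (hz : ∀ p, ‖z p‖ ≤ 1) {δ : ℝ} (hδ0 : 0 ≤ δ) (hδ : δ ≤ 1 / 10)
    (hreg : |(∑ p ∈ primeBlock L P, Real.log p) - ((P : ℝ) - L)| ≤ δ * ((P : ℝ) - L))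
    (hcan : ‖∑ p ∈ primeBlock L P, z p * (Real.log p : ℂ)‖ ≤ δ * ((P : ℝ) - L))
    {α : ℝ} (hα0 : 0 ≤ α) (hα1 : α ≤ 1) {t : ℝ} (ht : |t| * ((P : ℝ) - L) ≤ (L : ℝ) / 20) :
    1 / 4 * (((P : ℝ) - L) * (P : ℝ) ^ (-α) / Real.log Y) ≤
      ∑ p ∈ primeBlock L P, (p : ℝ) ^ (-α) * (1 - (z p * (p : ℂ) ^ (-((t : ℂ) * I))).re) := by
  -- basic positivity
  have hP0 : 0 < P := lt_of_le_of_lt (Nat.zero_le L) hLP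
  have hP0r : (0 : ℝ) < P := by exact_mod_cast hP0
  have hlogL0 : 0 < Real.log L := by linarith
  have hL1 : (1 : ℝ) < L := by
    by_contra h; push Not at h
    have : Real.log L ≤ 0 := Real.log_nonpos (Nat.cast_nonneg L) h
    linarith
  have hL0r : (0 : ℝ) < L := by linarith
  have hLPr : (L : ℝ) < P := by exact_mod_cast hLP
  have hPYr : (P : ℝ) ≤ Y := by exact_mod_cast hPY
  have hhh : 0 < (P : ℝ) - L := by linarith
  have hlogP : Real.log L ≤ Real.log P := Real.log_le_log hL0r hLPr.le
  have hlogPY : Real.log P ≤ Real.log Y := Real.log_le_log hP0r hPYr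
  have hlogP0 : 0 < Real.log P := by linarith
  have hlogY0 : 0 < Real.log Y := by linarith
  set hh : ℝ := (P : ℝ) - L with hhh_def
  set B := primeBlock L P with hB
  have hmem : ∀ p ∈ B, L < p ∧ p ≤ P ∧ p.Prime := fun p hp => by
    have := mem_primeBlock.mp hp; exact ⟨this.1.1, this.1.2, this.2⟩
  have hlogp : ∀ p ∈ B, Real.log L ≤ Real.log p ∧ Real.log p ≤ Real.log P := by
    intro p hp
    obtain ⟨h1, h2, -⟩ := hmem p hp
    exact ⟨Real.log_le_log hL0r (by exact_mod_cast h1.le), Real.log_le_log (by exact_mod_cast (lt_trans (by omega : 0 < L) h1 : 0 < p)) (by exact_mod_cast h2)⟩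
  -- `S₁ = ∑_B log p ∈ [(1−δ)hh, (1+δ)hh]`
  set S₁ : ℝ := ∑ p ∈ B, Real.log p with hS₁
  have hS₁lo : (1 - δ) * hh ≤ S₁ := by have := (abs_le.mp hreg).1; linarith
  have hS₁hi : S₁ ≤ (1 + δ) * hh := by have := (abs_le.mp hreg).2; linarith
  -- ### (ii) `∑_B p^{-α} ≥ P^{-α} S₁/log P ≥ (1−δ) hh P^{-α}/log Y`
  have hpow : ∀ p ∈ B, (P : ℝ) ^ (-α) ≤ (p : ℝ) ^ (-α) := by
    intro p hp
    obtain ⟨h1, h2, -⟩ := hmem p hp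
    have hp0 : (0 : ℝ) < p := by exact_mod_cast (lt_trans (by omega : 0 < L) h1)
    exact Real.rpow_le_rpow_of_nonpos hp0 (by exact_mod_cast h2) (by linarith)
  have hmain_pos : (1 - δ) * hh * (P : ℝ) ^ (-α) / Real.log Y ≤ ∑ p ∈ B, (p : ℝ) ^ (-α) := by
    have h1 : ∑ p ∈ B, (p : ℝ) ^ (-α) ≥ ∑ p ∈ B, (P : ℝ) ^ (-α) * (Real.log p / Real.log P) := by
      refine Finset.sum_le_sum fun p hp => ?_
      have hlp := (hlogp p hp).2
      have hr : Real.log p / Real.log P ≤ 1 := by rw [div_le_one hlogP0]; exact hlp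
      calc (P : ℝ) ^ (-α) * (Real.log p / Real.log P) ≤ (p : ℝ) ^ (-α) * 1 :=
            mul_le_mul (hpow p hp) hr (by positivity) (by positivity)
        _ = _ := mul_one _
    have h2 : ∑ p ∈ B, (P : ℝ) ^ (-α) * (Real.log p / Real.log P) = (P : ℝ) ^ (-α) * S₁ / Real.log P := by
      rw [hS₁, ← Finset.mul_sum, ← Finset.sum_div, mul_div_assoc]
    rw [h2] at h1
    have hPa : 0 < (P : ℝ) ^ (-α) := Real.rpow_pos_of_pos hP0r _
    have hS₁0 : 0 ≤ S₁ := le_trans (by nlinarith) hS₁lo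
    calc (1 - δ) * hh * (P : ℝ) ^ (-α) / Real.log Y ≤ (P : ℝ) ^ (-α) * S₁ / Real.log Y := by
          apply div_le_div_of_nonneg_right _ hlogY0.le
          nlinarith [mul_le_mul_of_nonneg_left hS₁lo hPa.le]
      _ ≤ (P : ℝ) ^ (-α) * S₁ / Real.log P :=
          div_le_div_of_nonneg_left (by positivity) hlogP0 hlogPY
      _ ≤ _ := h1
  -- ### (iii) `|∑_B z_p p^{-s}| ≤ P^{-α} |∑_B z_p| + (1/5) ∑_B p^{-α}`
  have hosc : ‖∑ p ∈ B, z p * (p : ℂ) ^ (-((α : ℂ) + t * I))‖ ≤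
      (P : ℝ) ^ (-α) * ‖∑ p ∈ B, z p‖ + 1 / 5 * ∑ p ∈ B, (p : ℝ) ^ (-α) := by
    have hsplit : ∑ p ∈ B, z p * (p : ℂ) ^ (-((α : ℂ) + t * I)) =
        (P : ℂ) ^ (-((α : ℂ) + t * I)) * ∑ p ∈ B, z p +
          ∑ p ∈ B, z p * ((p : ℂ) ^ (-((α : ℂ) + t * I)) - (P : ℂ) ^ (-((α : ℂ) + t * I))) := by
      rw [Finset.mul_sum, ← Finset.sum_add_distrib]
      refine Finset.sum_congr rfl fun p _ => by ring
    rw [hsplit]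
    calc _ ≤ ‖(P : ℂ) ^ (-((α : ℂ) + t * I)) * ∑ p ∈ B, z p‖ +
          ‖∑ p ∈ B, z p * ((p : ℂ) ^ (-((α : ℂ) + t * I)) - (P : ℂ) ^ (-((α : ℂ) + t * I)))‖ := norm_add_le _ _
      _ ≤ (P : ℝ) ^ (-α) * ‖∑ p ∈ B, z p‖ + ∑ p ∈ B, 1 / 5 * (p : ℝ) ^ (-α) := by
          apply add_le_add
          · rw [norm_mul, norm_natCast_cpow_neg_add hP0]
          · refine (norm_sum_le _ _).trans (Finset.sum_le_sum fun p hp => ?_)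
            obtain ⟨h1, h2, -⟩ := hmem p hp
            rw [norm_mul]
            calc ‖z p‖ * ‖(p : ℂ) ^ (-((α : ℂ) + t * I)) - (P : ℂ) ^ (-((α : ℂ) + t * I))‖ ≤ 1 * (1 / 5 * (p : ℝ) ^ (-α)) :=
                  mul_le_mul (hz p) (norm_cpow_sub_cpow_block_le h1 h2 h20 hα0 hα1 ht) (norm_nonneg _) zero_le_one
              _ = _ := one_mul _
      _ = _ := by rw [← Finset.mul_sum]
  -- ### (iv) `‖∑_B z_p‖ ≤ δ hh/log P + (1+δ) hh (1/log L − 1/log P)`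
  have hzsum : ‖∑ p ∈ B, z p‖ ≤ δ * hh / Real.log P + (1 + δ) * hh * (1 / Real.log L - 1 / Real.log P) := by
    -- `z_p = (z_p log p)(1/log P) + (z_p log p)(1/log p − 1/log P)`
    have hsplit : ∑ p ∈ B, z p = (1 / Real.log P : ℝ) • ∑ p ∈ B, z p * (Real.log p : ℂ) +
        ∑ p ∈ B, z p * (Real.log p : ℂ) * (((1 / Real.log p - 1 / Real.log P : ℝ)) : ℂ) := by
      rw [Finset.smul_sum, ← Finset.sum_add_distrib]
      refine Finset.sum_congr rfl fun p hp => ?_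
      have hlp0 : 0 < Real.log p := lt_of_lt_of_le hlogL0 (hlogp p hp).1
      have : ((Real.log p : ℝ) : ℂ) ≠ 0 := by exact_mod_cast hlp0.ne'
      have hP' : ((Real.log P : ℝ) : ℂ) ≠ 0 := by exact_mod_cast hlogP0.ne'
      simp only [Complex.real_smul, Complex.ofReal_sub, Complex.ofReal_div, Complex.ofReal_one]
      field_simp
      ring
    rw [hsplit]
    calc _ ≤ ‖(1 / Real.log P : ℝ) • ∑ p ∈ B, z p * (Real.log p : ℂ)‖ +
          ‖∑ p ∈ B, z p * (Real.log p : ℂ) * (((1 / Real.log p - 1 / Real.log P : ℝ)) : ℂ)‖ := norm_add_le _ _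
      _ ≤ 1 / Real.log P * (δ * hh) + ∑ p ∈ B, Real.log p * (1 / Real.log L - 1 / Real.log P) := by
          apply add_le_add
          · rw [norm_smul, Real.norm_eq_abs, abs_of_pos (by positivity)]
            exact mul_le_mul_of_nonneg_left hcan (by positivity)
          · refine (norm_sum_le _ _).trans (Finset.sum_le_sum fun p hp => ?_)
            obtain ⟨hl1, hl2⟩ := hlogp p hp
            have hlp0 : 0 < Real.log p := lt_of_lt_of_le hlogL0 hl1
            have hε0 : 0 ≤ 1 / Real.log p - 1 / Real.log P := by
              rw [sub_nonneg]; exact one_div_le_one_div_of_le hlp0 hl2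
            have hε1 : 1 / Real.log p - 1 / Real.log P ≤ 1 / Real.log L - 1 / Real.log P := by
              have := one_div_le_one_div_of_le hlogL0 hl1; linarith
            rw [norm_mul, norm_mul, Complex.norm_real, Complex.norm_real, Real.norm_eq_abs, Real.norm_eq_abs,
              abs_of_pos hlp0, abs_of_nonneg hε0]
            calc ‖z p‖ * Real.log p * (1 / Real.log p - 1 / Real.log P) ≤ 1 * Real.log p * (1 / Real.log L - 1 / Real.log P) := by
                  apply mul_le_mul (mul_le_mul_of_nonneg_right (hz p) hlp0.le) hε1 hε0 (by positivity)
              _ = _ := by rw [one_mul]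
      _ = δ * hh / Real.log P + S₁ * (1 / Real.log L - 1 / Real.log P) := by
          rw [hS₁, Finset.sum_mul]; ring
      _ ≤ δ * hh / Real.log P + (1 + δ) * hh * (1 / Real.log L - 1 / Real.log P) := by
          have hε : 0 ≤ 1 / Real.log L - 1 / Real.log P := by
            rw [sub_nonneg]; exact one_div_le_one_div_of_le hlogL0 hlogP
          nlinarith [mul_le_mul_of_nonneg_right hS₁hi hε]
  -- ### (v) numerics: `1/log L − 1/log P ≤ (hh/L)/log² L ≤ 1/(20 log² L)`, `log Y/log P ≤ 10/9`, ...
  have hεbound : 1 / Real.log L - 1 / Real.log P ≤ 1 / (20 * Real.log L ^ 2) := by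
    have h1 : Real.log P - Real.log L ≤ hh / L := by
      have h2 : Real.log P - Real.log L = Real.log ((P : ℝ) / L) := by rw [Real.log_div hP0r.ne' hL0r.ne']
      rw [h2]
      have h3 : Real.log ((P : ℝ) / L) ≤ (P : ℝ) / L - 1 := Real.log_le_sub_one_of_pos (by positivity)
      have h4 : (P : ℝ) / L - 1 = hh / L := by rw [hhh_def]; field_simp
      linarith
    have h20r : 20 * hh ≤ L := by
      have hLP' : L ≤ P := hLP.le
      have : ((20 * (P - L) : ℕ) : ℝ) ≤ L := by exact_mod_cast h20
      push_cast [Nat.cast_sub hLP'] at this; rw [hhh_def]; linarith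
    have h5 : hh / L ≤ 1 / 20 := by rw [div_le_div_iff₀ hL0r (by norm_num)]; linarith
    rw [div_sub_div _ _ hlogL0.ne' hlogP0.ne', one_mul, mul_one, div_le_div_iff₀ (by positivity) (by positivity)]
    have h6 : Real.log P - Real.log L ≤ 1 / 20 := h1.trans h5
    have h7 : 0 ≤ Real.log P - Real.log L := by linarith
    -- `(log P − log L) · 20 log²L ≤ log L · log P` since `log P − log L ≤ 1/20` and `log L ≤ log P`
    nlinarith [mul_le_mul_of_nonneg_left hlogP hlogL0.le]
  -- assemble: `D_B ≥ ∑ p^{-α} − ‖∑ z p^{-s}‖ ≥ (4/5)∑p^{-α} − P^{-α}‖∑ z‖`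
  have hre : ∑ p ∈ B, (p : ℝ) ^ (-α) * (1 - (z p * (p : ℂ) ^ (-((t : ℂ) * I))).re) =
      (∑ p ∈ B, (p : ℝ) ^ (-α)) - (∑ p ∈ B, z p * (p : ℂ) ^ (-((α : ℂ) + t * I))).re := by
    rw [Complex.re_sum, ← Finset.sum_sub_distrib]
    refine Finset.sum_congr rfl fun p hp => ?_
    obtain ⟨h1, -, -⟩ := hmem p hp
    have hp0 : 0 < p := lt_trans (by omega : 0 < L) h1
    have hsplit : (p : ℂ) ^ (-((α : ℂ) + t * I)) = (((p : ℝ) ^ (-α) : ℝ) : ℂ) * (p : ℂ) ^ (-((t : ℂ) * I)) := by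
      rw [neg_add, Complex.cpow_add _ _ (by exact_mod_cast hp0.ne'), Complex.ofReal_cpow (by positivity)]
      push_cast; ring_nf
    rw [hsplit, show z p * ((((p : ℝ) ^ (-α) : ℝ) : ℂ) * (p : ℂ) ^ (-((t : ℂ) * I))) =
      (((p : ℝ) ^ (-α) : ℝ) : ℂ) * (z p * (p : ℂ) ^ (-((t : ℂ) * I))) by ring, Complex.re_ofReal_mul]
    ring
  rw [hre]
  have hre_le : (∑ p ∈ B, z p * (p : ℂ) ^ (-((α : ℂ) + t * I))).re ≤
      (P : ℝ) ^ (-α) * ‖∑ p ∈ B, z p‖ + 1 / 5 * ∑ p ∈ B, (p : ℝ) ^ (-α) :=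
    (Complex.re_le_norm _).trans hosc
  -- final numerics
  have hPa : 0 < (P : ℝ) ^ (-α) := Real.rpow_pos_of_pos hP0r _
  have hS0 : 0 ≤ ∑ p ∈ B, (p : ℝ) ^ (-α) := Finset.sum_nonneg fun p _ => by positivity
  -- `P^{-α}‖∑ z‖ ≤ P^{-α} hh (1.12 δ + 0.0003·…)/log Y`: we show `P^{-α}‖∑ z‖ ≤ 0.115 · (1−δ)⁻¹ …`; concretely:
  have hkey : (P : ℝ) ^ (-α) * ‖∑ p ∈ B, z p‖ ≤ (115 / 1000 + 62 / 100000) * (hh * (P : ℝ) ^ (-α) / Real.log Y) := by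
    have h1 : ‖∑ p ∈ B, z p‖ ≤ δ * hh / Real.log P + (1 + δ) * hh * (1 / (20 * Real.log L ^ 2)) :=
      hzsum.trans (add_le_add_right (mul_le_mul_of_nonneg_left hεbound (by positivity : 0 ≤ (1 + δ) * hh)) _)
    -- `δ hh/log P ≤ (10/9) δ hh/log Y` and `(1+δ) hh/(20 log²L) ≤ (11/10)(10/9) hh/(20·20 log Y)`
    have h2 : δ * hh / Real.log P ≤ (10 / 9) * δ * (hh / Real.log Y) := by
      rw [div_le_iff₀ hlogP0]
      have : Real.log Y ≤ 10 / 9 * Real.log P := hlogY.trans (by nlinarith)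
      have h3 : 0 ≤ δ * hh := by positivity
      calc δ * hh = δ * hh / Real.log Y * Real.log Y := by field_simp
        _ ≤ δ * hh / Real.log Y * (10 / 9 * Real.log P) := mul_le_mul_of_nonneg_left this (by positivity)
        _ = _ := by ring
    have h3 : (1 + δ) * hh * (1 / (20 * Real.log L ^ 2)) ≤ (11 / 10) * (10 / 9) / 400 * (hh / Real.log Y) := by
      have hlogYL : Real.log Y ≤ 10 / 9 * Real.log L := hlogY
      rw [show (1 + δ) * hh * (1 / (20 * Real.log L ^ 2)) = (1 + δ) * hh / (20 * Real.log L ^ 2) by ring,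
        div_le_iff₀ (by positivity)]
      rw [show (11 / 10) * (10 / 9) / 400 * (hh / Real.log Y) * (20 * Real.log L ^ 2) =
        hh * ((11 / 10) * (10 / 9) / 20) * (Real.log L * (Real.log L / Real.log Y)) by ring]
      have h4 : 9 / 10 ≤ Real.log L / Real.log Y := by
        rw [le_div_iff₀ hlogY0]; linarith
      have h5 : (1 + δ) ≤ 11 / 10 := by linarith
      have h6 : (20 : ℝ) * (9 / 10) ≤ Real.log L * (Real.log L / Real.log Y) :=
        mul_le_mul hlogL h4 (by norm_num) hlogL0.le
      nlinarith
    calc (P : ℝ) ^ (-α) * ‖∑ p ∈ B, z p‖ ≤ (P : ℝ) ^ (-α) * ((10 / 9) * δ * (hh / Real.log Y) +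
          (11 / 10) * (10 / 9) / 400 * (hh / Real.log Y)) := by
          apply mul_le_mul_of_nonneg_left (h1.trans (add_le_add h2 h3)) hPa.le
      _ ≤ (115 / 1000 + 62 / 100000) * (hh * (P : ℝ) ^ (-α) / Real.log Y) := by
          have hδ' : (10 / 9) * δ ≤ 115 / 1000 := by linarith
          have hq : 0 ≤ hh / Real.log Y := by positivity
          rw [show (115 / 1000 + 62 / 100000) * (hh * (P : ℝ) ^ (-α) / Real.log Y) =
            (P : ℝ) ^ (-α) * ((115 / 1000 + 62 / 100000) * (hh / Real.log Y)) by ring]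
          apply mul_le_mul_of_nonneg_left _ hPa.le
          nlinarith
  -- combine: `∑ p^{-α}(1 − Re…) ≥ (4/5)∑p^{-α} − P^{-α}‖∑z‖ ≥ (4/5)(1−δ) W − 0.1157 W`, `W = hh P^{-α}/log Y`
  have hW0 : 0 ≤ hh * (P : ℝ) ^ (-α) / Real.log Y := by positivity
  have hlow : (1 - δ) * (hh * (P : ℝ) ^ (-α) / Real.log Y) ≤ ∑ p ∈ B, (p : ℝ) ^ (-α) := by
    calc (1 - δ) * (hh * (P : ℝ) ^ (-α) / Real.log Y) = (1 - δ) * hh * (P : ℝ) ^ (-α) / Real.log Y := by ring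
      _ ≤ _ := hmain_pos
  have h45 := mul_le_mul_of_nonneg_left hlow (by norm_num : (0 : ℝ) ≤ 4 / 5)
  have hδW := mul_le_mul_of_nonneg_right hδ hW0
  nlinarith [hlow, hkey, hre_le, hW0, hS0, h45, hδW]

/-! ### Consecutive blocks -/

/-- Splitting a prime block at an intermediate point. [folklore] -/
theorem sum_primeBlock_split {a b c : ℕ} (hab : a ≤ b) (hbc : b ≤ c) (f : ℕ → ℝ) :
    ∑ p ∈ primeBlock a c, f p = ∑ p ∈ primeBlock a b, f p + ∑ p ∈ primeBlock b c, f p := by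
  unfold primeBlock
  rw [← Finset.Ioc_union_Ioc_eq_Ioc hab hbc, Finset.filter_union, Finset.sum_union]
  exact Finset.disjoint_filter_filter ((Finset.Ioc_disjoint_Ioc_of_le le_rfl))

/-- The primes of `(Y − Jh, Y]` block by block: `∑_{(Y−Jh, Y]} = ∑_{j=1}^{J} ∑_{(Y−jh, Y−(j−1)h]}`. [folklore] -/
theorem sum_primeBlock_blocks (Y h : ℕ) : ∀ J : ℕ, J * h ≤ Y → ∀ f : ℕ → ℝ,
    ∑ p ∈ primeBlock (Y - J * h) Y, f p =
      ∑ j ∈ Finset.Icc 1 J, ∑ p ∈ primeBlock (Y - j * h) (Y - (j - 1) * h), f p := by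
  intro J
  induction J with
  | zero => intro _ f; simp [primeBlock]
  | succ J ih =>
      intro hJ f
      have hJ' : J * h ≤ Y := le_trans (Nat.mul_le_mul_right h (Nat.le_succ J)) hJ
      rw [Finset.sum_Icc_succ_top (by omega), ← ih hJ' f,
        sum_primeBlock_split (a := Y - (J + 1) * h) (b := Y - J * h) (c := Y) (by
          apply Nat.sub_le_sub_left; exact Nat.mul_le_mul_right h (Nat.le_succ J)) (Nat.sub_le _ _)]
      rw [show J + 1 - 1 = J from rfl, add_comm]

set_option maxHeartbeats 400000 in
/-- **Summing the block estimate over consecutive blocks.** With blocks `(Y − jh, Y − (j−1)h]`,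
`j = 1, …, J`, `Jh ≤ Y`, each regular (`|∑ log p − h| ≤ δh`) and cancelling (`‖∑ z_p log p‖ ≤ δh`),
`δ ≤ 1/10`, and `20h ≤ Y − Jh`, `log(Y − Jh) ≥ 20`, `log Y ≤ (10/9) log(Y − Jh)`, `|t| h ≤ (Y − Jh)/20`:
`(1/4) ∑_{j=1}^{J} h (Y − (j−1)h)^{−α}/log Y ≤ ∑_{p ∈ (Y−Jh, Y]} p^{−α}(1 − Re(z_p p^{−it}))`.
[cite: Harper2016, Appendix] -/
theorem sum_blocks_decay_lower_bound {Y h J : ℕ} (hJ : J * h ≤ Y) (hh1 : 1 ≤ h) (h20 : 20 * h ≤ Y - J * h)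
    (hlogL : 20 ≤ Real.log ((Y - J * h : ℕ) : ℝ)) (hlogY : Real.log Y ≤ 10 / 9 * Real.log ((Y - J * h : ℕ) : ℝ))
    (z : ℕ → ℂ) (hz : ∀ p, ‖z p‖ ≤ 1) {δ : ℝ} (hδ0 : 0 ≤ δ) (hδ : δ ≤ 1 / 10)
    (hreg : ∀ j ∈ Finset.Icc 1 J, |(∑ p ∈ primeBlock (Y - j * h) (Y - (j - 1) * h), Real.log p) - h| ≤ δ * h)
    (hcan : ∀ j ∈ Finset.Icc 1 J, ‖∑ p ∈ primeBlock (Y - j * h) (Y - (j - 1) * h), z p * (Real.log p : ℂ)‖ ≤ δ * h)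
    {α : ℝ} (hα0 : 0 ≤ α) (hα1 : α ≤ 1) {t : ℝ} (ht : |t| * h ≤ ((Y - J * h : ℕ) : ℝ) / 20) :
    1 / 4 * ∑ j ∈ Finset.Icc 1 J, ((h : ℝ) * (((Y - (j - 1) * h : ℕ) : ℝ)) ^ (-α) / Real.log Y) ≤
      ∑ p ∈ primeBlock (Y - J * h) Y, (p : ℝ) ^ (-α) * (1 - (z p * (p : ℂ) ^ (-((t : ℂ) * I))).re) := by
  rw [sum_primeBlock_blocks Y h J hJ, Finset.mul_sum]
  refine Finset.sum_le_sum fun j hj => ?_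
  obtain ⟨hj1, hjJ⟩ := Finset.mem_Icc.mp hj
  -- the block `L = Y − jh < P = Y − (j−1)h ≤ Y`
  have hjh : j * h ≤ Y := le_trans (Nat.mul_le_mul_right h hjJ) hJ
  have hj1h : (j - 1) * h ≤ Y := le_trans (Nat.mul_le_mul_right h (Nat.sub_le j 1)) hjh
  have hPL : (Y - (j - 1) * h) - (Y - j * h) = h := by
    have : j * h = (j - 1) * h + h := by
      calc j * h = ((j - 1) + 1) * h := by rw [Nat.sub_add_cancel hj1]
        _ = (j - 1) * h + h := by ring
    omega
  have hLP : Y - j * h < Y - (j - 1) * h := by omega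
  have hPY : Y - (j - 1) * h ≤ Y := Nat.sub_le _ _
  have hLge : Y - J * h ≤ Y - j * h := Nat.sub_le_sub_left (Nat.mul_le_mul_right h hjJ) Y
  have h20' : 20 * ((Y - (j - 1) * h) - (Y - j * h)) ≤ Y - j * h := by rw [hPL]; omega
  have hLpos : 0 < ((Y - J * h : ℕ) : ℝ) := by
    have : (0 : ℝ) < Real.log ((Y - J * h : ℕ) : ℝ) := by linarith
    by_contra hneg; push Not at hneg
    have := Real.log_nonpos (Nat.cast_nonneg _) (by linarith : ((Y - J * h : ℕ) : ℝ) ≤ 1)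
    linarith
  have hLge' : ((Y - J * h : ℕ) : ℝ) ≤ ((Y - j * h : ℕ) : ℝ) := by exact_mod_cast hLge
  have hlogLj : Real.log ((Y - J * h : ℕ) : ℝ) ≤ Real.log ((Y - j * h : ℕ) : ℝ) := Real.log_le_log hLpos hLge'
  have hdiff : (((Y - (j - 1) * h : ℕ) : ℝ)) - ((Y - j * h : ℕ) : ℝ) = h := by
    have h1 : (((Y - (j - 1) * h) - (Y - j * h) : ℕ) : ℝ) = (h : ℝ) := by exact_mod_cast hPL
    rw [Nat.cast_sub hLP.le] at h1
    exact h1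
  have hb := block_decay_lower_bound hLP hPY h20' (hlogL.trans hlogLj) (hlogY.trans (by nlinarith)) z hz hδ0 hδ
    (by rw [hdiff]; exact hreg j hj) (by rw [hdiff]; exact hcan j hj) hα0 hα1 (t := t)
    (by rw [hdiff]; exact ht.trans (by linarith))
  rw [hdiff] at hb
  exact hb

end SmoothArcs

end Literature.NumberTheory.Sieve

end
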